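import Mathlib.CategoryTheory.Groupoid
import Mathlib.CategoryTheory.Functor.FullyFaithful
import Mathlib.CategoryTheory.NatIso
import Mathlib.CategoryTheory.EssentialImage
import Mathlib.Data.Set.Image
import Literature.IUT.LogThetaLattice.PrimeStripFrame
import Literature.IUT.HodgeArakelov.RadialEnvironments
import HarnessLib

/-!
# [IUTchIII] Corollary 2.3 (i), (ii): the étale-picture of multiradial theta monoids — radial and coric data

Mochizuki, *Inter-universal Teichmüller Theory III*, kurims manuscript (May 2020), §2, Corollary 2.3,
pp. 72–75 [cite: Mochizuki2012, III Cor 2.3 pp.72–75], with the notion of (multi)radial environment of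
[IUTchII] Example 1.7 (ii) p.32 [cite: Mochizuki2012, II Ex 1.7 (ii) p.32] (D-0012 claim key, status
disputed; typed over interfaces; the one theorem proved is the formal content of Cor 2.3 (i) and
takes no side on anything else).

Printed text, [IUTchIII] Cor 2.3 (pp. 72–74): radial data
`†ℜ = (†HT^{D-Θ±ell NF}, F^⊩_{env}(†D_>), †ℜ^{bad}, F^{⊢×μ}_△(†D^⊢_△), F^{⊢×μ}_{env}(†D_>) ⥲ F^{⊢×μ}_△(†D^⊢_△))`
consisting of (a_ℜ) a `D-Θ^{±ell}NF`-Hodge theater; (b_ℜ) the `F^⊩`-prime-strip `F^⊩_{env}(†D_>)`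
[Prop 2.1 (ii)]; (c_ℜ) the data (a_v)–(d_v) of Thm 2.2 (ii) at `v ∈ V̲^{bad}`, `†ℜ^{bad}`; (d_ℜ) the
`F^{⊢×μ}`-prime-strip `F^{⊢×μ}_△(†D^⊢_△)` [Thm 1.5 (iii)]; (e_ℜ) "the full poly-isomorphism of
`F^{⊢×μ}`-prime-strips `F^{⊢×μ}_{env}(†D_>) ⥲ F^{⊢×μ}_△(†D^⊢_△)`". A morphism `†ℜ → ‡ℜ`: (a_{Morℜ}) an
isomorphism of `D`-Hodge theaters; (b_{Morℜ}), (c_{Morℜ}) the isomorphisms INDUCED by it; (d_{Morℜ}) "an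
isomorphism of `F^{⊢×μ}`-prime-strips `F^{⊢×μ}_△(†D^⊢_△) ⥲ F^{⊢×μ}_△(‡D^⊢_△)`"; (e_{Morℜ}) "[these] are
necessarily compatible with the poly-isomorphisms of (e_ℜ)". Coric data `†ℭ = (†D^⊢, F^{⊢×μ}(†D^⊢))`;
a morphism `†ℭ → ‡ℭ`: (a_{Morℭ}) an isomorphism `†D^⊢ ⥲ ‡D^⊢`; (b_{Morℭ}) an isomorphism
`F^{⊢×μ}(†D^⊢) ⥲ F^{⊢×μ}(‡D^⊢)` "that induces the isomorphism `†D^⊢ ⥲ ‡D^⊢` … of (a_{Morℭ})". "The radial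
algorithm is given by the assignment `†ℜ ↦ †ℭ = (†D^⊢_△, F^{⊢×μ}_△(†D^⊢_△))` — together with the
assignment on morphisms determined by the data of (d_{Morℜ})." Then: "(i) The functor associated to
the radial algorithm defined above is full and essentially surjective. In particular, the radial
environment defined above is multiradial." (ii): each `^{n,m}HT^D` gives `^{n,m}ℜ`; the vertical
arrows induce poly-isomorphisms `… ⥲ ^{n,m}ℜ ⥲ ^{n,m+1}ℜ ⥲ …`; the resulting étale-picture (Fig. 2.4)
admits "arbitrary permutation symmetries among the spokes" (`etalePicture.spokePerm`, `FrobeniusPicture.lean`).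

Typing. Radial environments / multiradiality are abc-iut-L6-t1's LANDED
`Literature.IUT.HodgeArakelov.RadialEnvironment` ([IUTchII] Ex 1.7; imported, no local stub — review of
p405506); accordingly `Radial` and `Coric` are GROUPOIDS ("each of whose morphisms is an isomorphism",
[IUTchII] Ex 1.7 (i)). The §2-specific functorial inputs are the
INTERFACE `ThetaCoricData` (`†HT^D ↦ †D^⊢_△`, `†D^⊢ ↦ F^{⊢×μ}(†D^⊢)`, `†HT^D ↦ F^⊩_{env}(†D_>)`, `†ℜ^{bad}`;
owners abc-iut-L6-t1/t2). Over it the categories `Radial` and `Coric` and the functor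
`radialAlgorithm` are DEFINED exactly as printed, and **Cor 2.3 (i) is PROVED**: `radialAlgorithm_full`
(a coric morphism `(d, δ)` lifts to `(ξ, δ)` for ANY isomorphism `ξ` of `D`-Hodge theaters, which exists
by connectedness — the morphism assignment "determined by the data of (d_{Morℜ})" ignores `ξ`) and
`radialAlgorithm_essSurj`. NOT here: Cor 2.3 (iii), (iv) (compatibilities with the Kummer isomorphisms
and the horizontal arrows) — `ThetaMonoids.lean`; the object "`^{n,◦}ℜ`" of (ii) (only the inducing
poly-isomorphisms are built).
-/

namespace Literature.IUT.LogThetaLattice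

open CategoryTheory
open Literature.IUT.HodgeTheaters

universe u

/-! ### The §2 interface: `†D^⊢_△`, `F^{⊢×μ}(†D^⊢)`, `F^⊩_{env}(†D_>)`, `†ℜ^{bad}` -/

/-- **IUTchIII:Cor2.3** (kurims p.72) INTERFACE for the functorial algorithms Cor 2.3 quotes (owners abc-iut-L6-t1/t2, TODO-merge):
`†HT^D ↦ †D^⊢_△` [Thm 1.5 (iii); IUTchII Cor 4.10 (i)], `†D^⊢ ↦ F^{⊢×μ}(†D^⊢)` [IUTchII, Cor 4.5 (ii);
Def 4.9 (vi)(vii)] with `D^⊢(F^{⊢×μ}(†D^⊢)) = †D^⊢`, `†HT^D ↦ F^⊩_{env}(†D_>)` [Prop 2.1 (ii)], the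
bad-prime data `†ℜ^{bad}` [Thm 2.2 (ii) (a_v)–(d_v)] as a functor to some category, and connectedness
of `D^⊢`-prime-strips. [claim: Mochizuki2012, status: disputed] -/
structure ThetaCoricData (S : StripFrame.{u}) where
  /-- `†HT^{D-Θ±ell NF} ↦ †D^⊢_△`, the `D^⊢`-prime-strip associated to `†F^⊢_△` [Thm 1.5 (iii)] -/
  dvDelta : S.DHT ⥤ S.Dv
  /-- `†D^⊢ ↦ F^{⊢×μ}(†D^⊢)` [IUTchII, Cor 4.5 (ii); Def 4.9 (vi), (vii)]; at `†D^⊢_△` this is `F^{⊢×μ}_△(†D^⊢_△)` -/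
  fxmOfDv : S.Dv ⥤ S.Fxm
  /-- the `D^⊢`-prime-strip associated to `F^{⊢×μ}(†D^⊢)` is `†D^⊢` itself -/
  fxmOfDv_dv : fxmOfDv ⋙ S.FxmToDv ≅ 𝟭 S.Dv
  /-- `†HT^D ↦ F^⊩_{env}(†D_>)`, the `F^⊩`-prime-strip of vertically coric theta monoids [Prop 2.1 (ii)] -/
  fglEnv : S.DHT ⥤ S.Fgl
  /-- the category in which the bad-prime data `†ℜ^{bad}` = (a_v)–(d_v) of Thm 2.2 (ii) live -/
  Rbad : Type u
  [catRbad : Category.{u} Rbad]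
  /-- `†HT^D ↦ †ℜ^{bad}` [Cor 2.3 (c_ℜ), induced morphisms (c_{Morℜ})] -/
  rbad : S.DHT ⥤ Rbad
  /-- any two `D^⊢`-prime-strips are isomorphic [IUTchI, Def 4.1 (iv)] -/
  iso_nonempty_Dv : ∀ X Y : S.Dv, Nonempty (X ≅ Y)

attribute [instance] ThetaCoricData.catRbad

namespace ThetaCoricData

variable {S : StripFrame.{u}} (E : ThetaCoricData S)

/-- **IUTchIII:Cor2.3** (kurims p.73) `D^⊢(F^{⊢×μ}(†D^⊢)) ≅ †D^⊢` at one object (component of `fxmOfDv_dv`, with syntactically plain type). [claim: Mochizuki2012, status: disputed] -/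
def dvIso (D : S.Dv) : S.FxmToDv.obj (E.fxmOfDv.obj D) ≅ D where
  hom := E.fxmOfDv_dv.hom.app D
  inv := E.fxmOfDv_dv.inv.app D
  hom_inv_id := E.fxmOfDv_dv.hom_inv_id_app D
  inv_hom_id := E.fxmOfDv_dv.inv_hom_id_app D

/-- **IUTchIII:Cor2.3** (kurims p.73) Naturality of `dvIso` (hom level). [claim: Mochizuki2012, status: disputed] -/
@[reassoc] theorem dvIso_hom_naturality {D D' : S.Dv} (d : D ⟶ D') :
    S.FxmToDv.map (E.fxmOfDv.map d) ≫ (E.dvIso D').hom = (E.dvIso D).hom ≫ d :=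
  E.fxmOfDv_dv.hom.naturality d

/-- **IUTchIII:Cor2.3** (kurims p.73) Naturality of `dvIso`: the `D^⊢`-isomorphism induced by `F^{⊢×μ}(d)` is `d`. [claim: Mochizuki2012, status: disputed] -/
theorem mapIso_fxmOfDv_dv {D D' : S.Dv} (d : D ≅ D') :
    S.FxmToDv.mapIso (E.fxmOfDv.mapIso d) = E.dvIso D ≪≫ d ≪≫ (E.dvIso D').symm := by
  ext
  rw [Functor.mapIso_hom, Functor.mapIso_hom, Iso.trans_hom, Iso.trans_hom, Iso.symm_hom,
    ← Category.assoc, Iso.eq_comp_inv]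
  exact E.dvIso_hom_naturality d.hom

/-- **IUTchIII:Cor2.3** (kurims p.73) `†HT^D ↦ F^{⊢×μ}_△(†D^⊢_△)` [Cor 2.3 (d_ℜ)]. [claim: Mochizuki2012, status: disputed] -/
abbrev fxmDelta : S.DHT ⥤ S.Fxm := E.dvDelta ⋙ E.fxmOfDv

/-- **IUTchIII:Cor2.3** (kurims p.73) `†HT^D ↦ F^{⊢×μ}_{env}(†D_>)`, the `F^{⊢×μ}`-prime-strip associated to `F^⊩_{env}(†D_>)` [Cor 2.3 (e_ℜ)]. [claim: Mochizuki2012, status: disputed] -/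
abbrev fxmEnv : S.DHT ⥤ S.Fxm := E.fglEnv ⋙ S.FglToFv ⋙ S.FvToFxm

end ThetaCoricData

/-! ### Cor 2.3: radial data, coric data, the radial algorithm -/

variable {S : StripFrame.{u}} (E : ThetaCoricData S)

/-- **IUTchIII:Cor2.3** (kurims p.72) **Cor 2.3, radial data `†ℜ`**: determined by (a_ℜ) the `D-Θ^{±ell}NF`-Hodge theater; the components
(b_ℜ)–(d_ℜ) are functorial in it and (e_ℜ) is the full poly-isomorphism (no data). [claim: Mochizuki2012, status: disputed] -/
structure Radial (E : ThetaCoricData S) where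
  /-- (a_ℜ) `†HT^{D-Θ±ell NF}` -/
  ht : S.DHT

namespace Radial

variable {E}

/-- **IUTchIII:Cor2.3** (kurims p.72) (b_ℜ) `F^⊩_{env}(†D_>)`. [claim: Mochizuki2012, status: disputed] -/
abbrev fglEnv (R : Radial E) : S.Fgl := E.fglEnv.obj R.ht

/-- **IUTchIII:Cor2.3** (kurims p.73) (c_ℜ) `†ℜ^{bad}`. [claim: Mochizuki2012, status: disputed] -/
abbrev rbad (R : Radial E) : E.Rbad := E.rbad.obj R.ht

/-- **IUTchIII:Cor2.3** (kurims p.73) `†D^⊢_△`. [claim: Mochizuki2012, status: disputed] -/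
abbrev dvDelta (R : Radial E) : S.Dv := E.dvDelta.obj R.ht

/-- **IUTchIII:Cor2.3** (kurims p.73) (d_ℜ) `F^{⊢×μ}_△(†D^⊢_△)`. [claim: Mochizuki2012, status: disputed] -/
abbrev fxmDelta (R : Radial E) : S.Fxm := E.fxmOfDv.obj (E.dvDelta.obj R.ht)

/-- **IUTchIII:Cor2.3** (kurims p.73) (e_ℜ) "the full poly-isomorphism of `F^{⊢×μ}`-prime-strips `F^{⊢×μ}_{env}(†D_>) ⥲ F^{⊢×μ}_△(†D^⊢_△)`". [claim: Mochizuki2012, status: disputed] -/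
def envToDelta (R : Radial E) : PolyIso (E.fxmEnv.obj R.ht) R.fxmDelta := PolyIso.full _ _

/-- **IUTchIII:Cor2.3** (kurims p.73) **A morphism of radial data `†ℜ → ‡ℜ`**: (a_{Morℜ}) an isomorphism of `D`-Hodge theaters and
(d_{Morℜ}) an isomorphism `F^{⊢×μ}_△(†D^⊢_△) ⥲ F^{⊢×μ}_△(‡D^⊢_△)`; (b),(c) are induced by (a), and (e) is
automatic. [claim: Mochizuki2012, status: disputed] -/
@[ext] structure Hom (R R' : Radial E) where
  /-- (a_{Morℜ}) `†HT^D ⥲ ‡HT^D` -/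
  ξ : R.ht ≅ R'.ht
  /-- (d_{Morℜ}) `F^{⊢×μ}_△(†D^⊢_△) ⥲ F^{⊢×μ}_△(‡D^⊢_△)` -/
  δ : E.fxmOfDv.obj (E.dvDelta.obj R.ht) ≅ E.fxmOfDv.obj (E.dvDelta.obj R'.ht)

/-- **IUTchIII:Cor2.3** (kurims p.73) Radial data and their morphisms form a category (indeed a groupoid). [claim: Mochizuki2012, status: disputed] -/
instance : Category (Radial E) where
  Hom := Hom
  id R := ⟨Iso.refl _, Iso.refl _⟩
  comp f g := ⟨f.ξ ≪≫ g.ξ, f.δ ≪≫ g.δ⟩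
  id_comp f := by ext <;> simp
  comp_id f := by ext <;> simp
  assoc f g h := by ext <;> simp

/-- **IUTchIII:Cor2.3** (kurims p.73) Extensionality of morphisms of radial data. [claim: Mochizuki2012, status: disputed] -/
@[ext] theorem hom_ext {R R' : Radial E} {f g : R ⟶ R'} (h₁ : f.ξ = g.ξ) (h₂ : f.δ = g.δ) : f = g :=
  Hom.ext h₁ h₂

/-- **IUTchIII:Cor2.3** (kurims p.73) (a)-component of a composite. [claim: Mochizuki2012, status: disputed] -/
@[simp] theorem comp_ξ {R R' R'' : Radial E} (f : R ⟶ R') (g : R' ⟶ R'') : (f ≫ g).ξ = f.ξ ≪≫ g.ξ := rfl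

/-- **IUTchIII:Cor2.3** (kurims p.73) (d)-component of a composite. [claim: Mochizuki2012, status: disputed] -/
@[simp] theorem comp_δ {R R' R'' : Radial E} (f : R ⟶ R') (g : R' ⟶ R'') : (f ≫ g).δ = f.δ ≪≫ g.δ := rfl

/-- **IUTchIII:Cor2.3** (kurims p.73) (a)-component of the identity. [claim: Mochizuki2012, status: disputed] -/
@[simp] theorem id_ξ (R : Radial E) : (𝟙 R : R ⟶ R).ξ = Iso.refl _ := rfl

/-- **IUTchIII:Cor2.3** (kurims p.73) (d)-component of the identity. [claim: Mochizuki2012, status: disputed] -/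
@[simp] theorem id_δ (R : Radial E) : (𝟙 R : R ⟶ R).δ = Iso.refl _ := rfl

/-- **IUTchIII:Cor2.3** (kurims p.73) `ℜ` is a groupoid: "each of whose morphisms is an isomorphism"
[IUTchII, Ex 1.7 (i)]. [claim: Mochizuki2012, status: disputed] -/
instance : Groupoid (Radial E) where
  inv f := ⟨f.ξ.symm, f.δ.symm⟩
  inv_comp f := by ext <;> simp
  comp_inv f := by ext <;> simp

/-- **IUTchIII:Cor2.3** (kurims p.73) (b_{Morℜ}) the induced isomorphism `F^⊩_{env}(†D_>) ⥲ F^⊩_{env}(‡D_>)`. [claim: Mochizuki2012, status: disputed] -/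
def Hom.fglEnvIso {R R' : Radial E} (f : R ⟶ R') : R.fglEnv ≅ R'.fglEnv := E.fglEnv.mapIso f.ξ

/-- **IUTchIII:Cor2.3** (kurims p.73) (c_{Morℜ}) the induced isomorphism `†ℜ^{bad} ⥲ ‡ℜ^{bad}`. [claim: Mochizuki2012, status: disputed] -/
def Hom.rbadIso {R R' : Radial E} (f : R ⟶ R') : R.rbad ≅ R'.rbad := E.rbad.mapIso f.ξ

/-- **IUTchIII:Cor2.3** (kurims p.73) (e_{Morℜ}): the isomorphisms (b_{Morℜ}), (d_{Morℜ}) "are necessarily compatible with the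
poly-isomorphisms of (e_ℜ)" — conjugating the FULL poly-isomorphism by any isomorphisms (on the left by
any `α`, e.g. the one induced by (b_{Morℜ}); on the right by (d_{Morℜ})) gives the full poly-isomorphism. [claim: Mochizuki2012, status: disputed] -/
theorem Hom.compatible_envToDelta {R R' : Radial E} (f : R ⟶ R')
    (α : E.fxmEnv.obj R.ht ≅ E.fxmEnv.obj R'.ht) :
    ((PolyIso.single α.symm).comp R.envToDelta).comp (PolyIso.single f.δ) = R'.envToDelta := by
  show ((PolyIso.single α.symm).comp (PolyIso.full _ _)).comp (PolyIso.single f.δ) = PolyIso.full _ _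
  rw [PolyIso.comp_full_of_nonempty (P := PolyIso.single α.symm) ⟨α.symm, rfl⟩,
    PolyIso.full_comp_of_nonempty (Q := PolyIso.single f.δ) ⟨f.δ, rfl⟩]

/-- **IUTchIII:Cor2.3(ii)** (kurims p.74) Every isomorphism of `D`-Hodge theaters induces a morphism of radial data (taking (d_{Morℜ}) to be
the induced isomorphism). [claim: Mochizuki2012, status: disputed] -/
def Hom.ofDHT {R R' : Radial E} (ξ : R.ht ≅ R'.ht) : R ⟶ R' := ⟨ξ, E.fxmOfDv.mapIso (E.dvDelta.mapIso ξ)⟩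

end Radial

/-- **IUTchIII:Cor2.3** (kurims p.73) **Cor 2.3, coric data `†ℭ = (†D^⊢, F^{⊢×μ}(†D^⊢))`**: determined by (a_ℭ) the `D^⊢`-prime-strip. [claim: Mochizuki2012, status: disputed] -/
structure Coric (E : ThetaCoricData S) where
  /-- (a_ℭ) `†D^⊢` -/
  dv : S.Dv

namespace Coric

variable {E}

/-- **IUTchIII:Cor2.3** (kurims p.73) (b_ℭ) `F^{⊢×μ}(†D^⊢)`. [claim: Mochizuki2012, status: disputed] -/
abbrev fxm (C : Coric E) : S.Fxm := E.fxmOfDv.obj C.dv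

/-- **IUTchIII:Cor2.3** (kurims p.73) **A morphism of coric data `†ℭ → ‡ℭ`**: (a_{Morℭ}) `†D^⊢ ⥲ ‡D^⊢` and (b_{Morℭ}) an isomorphism
`F^{⊢×μ}(†D^⊢) ⥲ F^{⊢×μ}(‡D^⊢)` "that induces the isomorphism `†D^⊢ ⥲ ‡D^⊢` on associated `D^⊢`-prime-strips of
(a_{Morℭ})". [claim: Mochizuki2012, status: disputed] -/
@[ext] structure Hom (C C' : Coric E) where
  /-- (a_{Morℭ}) -/
  d : C.dv ≅ C'.dv
  /-- (b_{Morℭ}) -/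
  δ : E.fxmOfDv.obj C.dv ≅ E.fxmOfDv.obj C'.dv
  /-- "(b) induces (a)" -/
  induces : S.FxmToDv.mapIso δ = E.dvIso C.dv ≪≫ d ≪≫ (E.dvIso C'.dv).symm

/-- **IUTchIII:Cor2.3** (kurims p.73) Coric data and their morphisms form a category. [claim: Mochizuki2012, status: disputed] -/
instance : Category (Coric E) where
  Hom := Hom
  id C := ⟨Iso.refl _, Iso.refl _, by
    rw [Functor.mapIso_refl, Iso.refl_trans, Iso.self_symm_id]⟩
  comp f g := ⟨f.d ≪≫ g.d, f.δ ≪≫ g.δ, by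
    rw [Functor.mapIso_trans, f.induces, g.induces, Iso.trans_assoc, Iso.trans_assoc, Iso.trans_assoc,
      Iso.symm_self_id_assoc]⟩
  id_comp f := by ext <;> simp
  comp_id f := by ext <;> simp
  assoc f g h := by ext <;> simp

/-- **IUTchIII:Cor2.3** (kurims p.73) Extensionality of morphisms of coric data. [claim: Mochizuki2012, status: disputed] -/
@[ext] theorem hom_ext {C C' : Coric E} {f g : C ⟶ C'} (h₁ : f.d = g.d) (h₂ : f.δ = g.δ) : f = g :=
  Hom.ext h₁ h₂

/-- **IUTchIII:Cor2.3** (kurims p.73) (a)-component of a composite. [claim: Mochizuki2012, status: disputed] -/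
@[simp] theorem comp_d {C C' C'' : Coric E} (f : C ⟶ C') (g : C' ⟶ C'') : (f ≫ g).d = f.d ≪≫ g.d := rfl

/-- **IUTchIII:Cor2.3** (kurims p.73) (b)-component of a composite. [claim: Mochizuki2012, status: disputed] -/
@[simp] theorem comp_δ {C C' C'' : Coric E} (f : C ⟶ C') (g : C' ⟶ C'') : (f ≫ g).δ = f.δ ≪≫ g.δ := rfl

/-- **IUTchIII:Cor2.3** (kurims p.73) (a)-component of the identity. [claim: Mochizuki2012, status: disputed] -/
@[simp] theorem id_d (C : Coric E) : (𝟙 C : C ⟶ C).d = Iso.refl _ := rfl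

/-- **IUTchIII:Cor2.3** (kurims p.73) (b)-component of the identity. [claim: Mochizuki2012, status: disputed] -/
@[simp] theorem id_δ (C : Coric E) : (𝟙 C : C ⟶ C).δ = Iso.refl _ := rfl

/-- **IUTchIII:Cor2.3** (kurims p.73) `ℭ` is a groupoid (the inverse pair again satisfies "(b) induces (a)").
[claim: Mochizuki2012, status: disputed] -/
instance : Groupoid (Coric E) where
  inv f := ⟨f.d.symm, f.δ.symm, by
    rw [Functor.mapIso_symm, f.induces, Iso.trans_symm, Iso.trans_symm, Iso.symm_symm_eq, Iso.trans_assoc]⟩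
  inv_comp f := by ext <;> simp
  comp_inv f := by ext <;> simp

end Coric

/-- **IUTchIII:Cor2.3** (kurims p.73) The `D^⊢`-isomorphism `†D^⊢_△ ⥲ ‡D^⊢_△` induced by (d_{Morℜ}) (the associated `D^⊢`-prime-strip of an
`F^{⊢×μ}`-prime-strip is functorial). [claim: Mochizuki2012, status: disputed] -/
def Radial.Hom.inducedDv {R R' : Radial E} (f : R ⟶ R') : E.dvDelta.obj R.ht ≅ E.dvDelta.obj R'.ht :=
  (E.dvIso _).symm ≪≫ S.FxmToDv.mapIso f.δ ≪≫ E.dvIso _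

/-- **IUTchIII:Cor2.3** (kurims p.73) **Cor 2.3, the radial algorithm** "`†ℜ ↦ †ℭ = (†D^⊢_△, F^{⊢×μ}_△(†D^⊢_△))` — together with the
assignment on morphisms determined by the data of (d_{Morℜ})", as a functor. [claim: Mochizuki2012, status: disputed] -/
def radialAlgorithm : Radial E ⥤ Coric E where
  obj R := ⟨E.dvDelta.obj R.ht⟩
  map f := ⟨Radial.Hom.inducedDv E f, f.δ, by
    rw [Radial.Hom.inducedDv, Iso.trans_assoc, Iso.trans_assoc, Iso.self_symm_id, Iso.trans_refl,
      Iso.self_symm_id_assoc]⟩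
  map_id R := by
    ext
    · show ((E.dvIso _).symm ≪≫ S.FxmToDv.mapIso (Iso.refl _) ≪≫ E.dvIso _).hom = 𝟙 _
      simp
    · rfl
  map_comp f g := by
    ext
    · show ((E.dvIso _).symm ≪≫ S.FxmToDv.mapIso (f.δ ≪≫ g.δ) ≪≫ E.dvIso _).hom =
        ((E.dvIso _).symm ≪≫ S.FxmToDv.mapIso f.δ ≪≫ E.dvIso _).hom ≫
          ((E.dvIso _).symm ≪≫ S.FxmToDv.mapIso g.δ ≪≫ E.dvIso _).hom
      simp
    · rfl

/-- **IUTchIII:Cor2.3** (kurims p.73) Components of the radial algorithm on morphisms. [claim: Mochizuki2012, status: disputed] -/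
@[simp] theorem radialAlgorithm_map_δ {R R' : Radial E} (f : R ⟶ R') :
    ((radialAlgorithm E).map f).δ = f.δ := rfl

/-- **IUTchIII:Cor2.3** (kurims p.73) Components of the radial algorithm on morphisms. [claim: Mochizuki2012, status: disputed] -/
theorem radialAlgorithm_map_d {R R' : Radial E} (f : R ⟶ R') :
    ((radialAlgorithm E).map f).d = Radial.Hom.inducedDv E f := rfl

/-- **IUTchIII:Cor2.3(i)** (kurims p.74) **Cor 2.3 (i), first half: "The functor associated to the radial algorithm defined above is full"**
— a morphism of coric data `(d, δ)` between `Φ(†ℜ)` and `Φ(‡ℜ)` is the image of `(ξ, δ)` for ANY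
isomorphism `ξ : †HT^D ⥲ ‡HT^D` (one exists: `D`-Hodge theaters are mutually isomorphic), because the
morphism assignment is "determined by the data of (d_{Morℜ})" alone. [claim: Mochizuki2012, status: disputed] -/
theorem radialAlgorithm_full : (radialAlgorithm E).Full where
  map_surjective {R R'} g := by
    refine ⟨⟨(S.iso_nonempty_DHT R.ht R'.ht).some, g.δ⟩, ?_⟩
    ext
    · -- the induced `D^⊢`-isomorphism is `g.d`, by the "induces" condition on `g`
      rw [radialAlgorithm_map_d, Radial.Hom.inducedDv]
      show ((E.dvIso _).symm ≪≫ S.FxmToDv.mapIso g.δ ≪≫ E.dvIso _).hom = g.d.hom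
      rw [g.induces]
      simp
    · rfl

/-- **IUTchIII:Cor2.3(i)** (kurims p.74) **Cor 2.3 (i), second half: "… and essentially surjective"** (given at least one `D`-Hodge theater:
every coric datum `(†D^⊢, F^{⊢×μ}(†D^⊢))` is isomorphic to `Φ(†ℜ)`, all `D^⊢`-prime-strips being isomorphic). [claim: Mochizuki2012, status: disputed] -/
theorem radialAlgorithm_essSurj [Nonempty S.DHT] : (radialAlgorithm E).EssSurj where
  mem_essImage C := by
    let R : Radial E := ⟨Classical.arbitrary S.DHT⟩
    let d : R.dvDelta ≅ C.dv := (E.iso_nonempty_Dv _ _).some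
    exact ⟨R, ⟨⟨d, E.fxmOfDv.mapIso d, E.mapIso_fxmOfDv_dv d⟩, ⟨d.symm, E.fxmOfDv.mapIso d.symm,
      E.mapIso_fxmOfDv_dv d.symm⟩, by ext <;> simp, by ext <;> simp⟩⟩

/-- **IUTchIII:Cor2.3** (kurims p.73) The radial environment of Cor 2.3: `(ℜ, ℭ, Φ = radialAlgorithm)` as a
RADIAL ENVIRONMENT in the sense of [IUTchII] Ex 1.7 (abc-iut-L6-t1's `RadialEnvironment`: groupoids + an
essentially surjective functor — essential surjectivity is Cor 2.3 (i), second half; one `D`-Hodge theater is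
assumed to exist). [claim: Mochizuki2012, status: disputed] -/
noncomputable def thetaRadialEnvironment [Nonempty S.DHT] : Literature.IUT.HodgeArakelov.RadialEnvironment.{u, u} where
  R := Radial E
  C := Coric E
  Φ := radialAlgorithm E
  essSurj := radialAlgorithm_essSurj E

/-- **IUTchIII:Cor2.3(i)** (kurims p.74) **Cor 2.3 (i), conclusion: "In particular, the radial environment defined
above is multiradial"** (L6-t1's `RadialEnvironment.IsMultiradial` = fullness of `Φ`). [Rmk 2.3.2 pp.75–76: "a
similar result … concerning the Kummer theory of `∞κ`-coric structures [IUTchII, Cor 4.8] … routine details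
… left to the reader" — the construction `Radial`/`Coric`/`radialAlgorithm` and this theorem are generic in the
input `E`; the `∞κ`-coric instantiation of `E` itself is not built here.] [claim: Mochizuki2012, status: disputed] -/
theorem thetaRadialEnvironment_isMultiradial [Nonempty S.DHT] : (thetaRadialEnvironment E).IsMultiradial :=
  radialAlgorithm_full E

/-! ### Cor 2.3 (ii): the radial data of a Gaussian log-theta-lattice -/

/-- **IUTchIII:Cor2.3(ii)** (kurims p.74) **Cor 2.3 (ii)**: "Each `D-Θ^{±ell}NF`-Hodge theater `^{n,m}HT^D`, for `n, m ∈ ℤ`, defines, in an evident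
way, an associated collection of radial data `^{n,m}ℜ`" — for a family of `D`-Hodge theaters indexed by
`ℤ × ℤ` (the `D`-Hodge theaters of a log-theta-lattice, Def 1.4). [claim: Mochizuki2012, status: disputed] -/
def latticeRadial (H : ℤ × ℤ → S.DHT) (p : ℤ × ℤ) : Radial E := ⟨H p⟩

/-- **IUTchIII:Cor2.3(ii)** (kurims p.74) **Cor 2.3 (ii)**: "The poly-isomorphisms induced by the vertical arrows of the Gaussian
log-theta-lattice [cf. Theorem 1.5, (i)]" — i.e. by the FULL poly-isomorphisms `^{n,m}HT^D ⥲ ^{n,m+1}HT^D`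
— "induce poly-isomorphisms of radial data `… ⥲ ^{n,m}ℜ ⥲ ^{n,m+1}ℜ ⥲ …`": the set of morphisms of
radial data induced (`Radial.Hom.ofDHT`) by all isomorphisms of `D`-Hodge theaters. [claim: Mochizuki2012, status: disputed] -/
def verticalRadialPolyIso (H : ℤ × ℤ → S.DHT) (n m : ℤ) :
    Set (latticeRadial E H (n, m) ⟶ latticeRadial E H (n, m + 1)) :=
  Set.range fun ξ : H (n, m) ≅ H (n, m + 1) => Radial.Hom.ofDHT (E := E) ξ

/-- **IUTchIII:Cor2.3(ii)** (kurims p.74) The induced poly-isomorphism of radial data is nonempty. [claim: Mochizuki2012, status: disputed] -/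
theorem verticalRadialPolyIso_nonempty (H : ℤ × ℤ → S.DHT) (n m : ℤ) :
    (verticalRadialPolyIso E H n m).Nonempty :=
  Set.range_nonempty_iff_nonempty.mpr (S.iso_nonempty_DHT _ _)

/-- **IUTchIII:Cor2.3(ii)** (kurims p.74) **Cor 2.3 (ii)**, horizontal identification: the coric data `Φ(^{n,m}ℜ)` along a horizontal line are
related by the morphisms of coric data induced by arbitrary isomorphisms `^{n,m}D^⊢_△ ⥲ ^{n+1,m}D^⊢_△`
(Thm 1.5 (ii): the horizontal arrows induce the FULL poly-isomorphism there) — giving the single hub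
`F^{⊢×μ}_△(^{◦,◦}D^⊢_△)` of Fig. 2.4. [claim: Mochizuki2012, status: disputed] -/
def horizontalCoricPolyIso (H : ℤ × ℤ → S.DHT) (n m : ℤ) :
    Set ((radialAlgorithm E).obj (latticeRadial E H (n, m)) ⟶
      (radialAlgorithm E).obj (latticeRadial E H (n + 1, m))) :=
  Set.range fun d : E.dvDelta.obj (H (n, m)) ≅ E.dvDelta.obj (H (n + 1, m)) =>
    (⟨d, E.fxmOfDv.mapIso d, E.mapIso_fxmOfDv_dv d⟩ : Coric.Hom _ _)

/-- **IUTchIII:Cor2.3(ii)** (kurims p.74) The horizontal identification is nonempty. [claim: Mochizuki2012, status: disputed] -/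
theorem horizontalCoricPolyIso_nonempty (H : ℤ × ℤ → S.DHT) (n m : ℤ) :
    (horizontalCoricPolyIso E H n m).Nonempty :=
  Set.range_nonempty_iff_nonempty.mpr (E.iso_nonempty_Dv _ _)

end Literature.IUT.LogThetaLattice
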